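import Summits.BirchSwinnertonDyer.BirchSwinnertonDyer.Theorems.Rank2Observatory2DescMuMap

/-!
# BirchSwinnertonDyer — rank ≥ 2 observatory: the kernel of the cubic-field `2`-descent map

HONEST FRAMING: per-curve certified theorems and census instruments; no claim on BSD in rank ≥ 2.

Second generic file of the KERNEL-2DESC instrument (design `b2b-bsdr2-cert-3/KERNEL-2DESC.md`):
Cassels, *Lectures on Elliptic Curves* (LMSST 24, 1991), §15 **Lemma 2** — the kernel of
`μ : (x, y) ↦ x − e` is `2E(F)` — for a curve `y² = x³ + a₂x² + a₄x + a₆` over a field `F`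
(`a₁ = a₃ = 0`, the shape of the observatory's `b`-models) and a root `e` of the cubic in an
extension `φ : F →+* K` over which `1, e, e²` are `F`-linearly independent (i.e. the `2`-division
cubic is irreducible over `F` and `e` generates the cubic field):

* `exists_eq_two_nsmul_of_sub_eq_sq` — if `a − e = (p₂e² + p₁e + p₀)²` with `pᵢ ∈ F` for an
  affine point `P = (a, b) ∈ E(F)`, then `P = 2Q` for an explicit `Q = (s₀, r₁s₀ + r₀) ∈ E(F)`:
  Cassels' argument verbatim — `p₂ ≠ 0`, `s₀ = (p₁ − p₂a₂)/p₂` makes `(s₀ − e)(p₂e² + p₁e + p₀)`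
  linear in `e`, `= r₁e + r₀`; comparing `(r₁X + r₀)² + (X − s₀)²(X − a)` with the cubic (both
  monic, both vanish at `e`) shows the line `Y = r₁X + r₀` is tangent at `Q` with third point
  `(a, ±b)`;
* `exists_eq_two_nsmul_of_sqClass_eq_one` — the same from `(φ a − e)·(Kˣ)² = 1` when every
  element of `K` is an `F`-combination of `1, e, e²` (`K = F(e)`);
* `exists_eq_two_nsmul_of_muMap_eq_one`, `muHom_ker_le` — packaged for the descent map `muMap` /
  `muHom` of `Rank2Observatory2DescMuMap`: `ker μ ⊆ 2E(F)`, exactly the hypothesis `hker` of the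
  counting lemma `two_pow_finrank_le_natCard_range` there.

Pure algebra over `F`; the field `K` only supplies the three coefficient identities. Sorry-free;
axioms `propext`, `Classical.choice`, `Quot.sound`. Reference: J. W. S. Cassels, *Lectures on
Elliptic Curves*, LMS Student Texts 24 (1991), §15 Lemma 2.
-/

-- single-conjunct summit: `Summit.BirchSwinnertonDyer.BirchSwinnertonDyer.…` repeats the name by design
set_option linter.dupNamespace false

noncomputable section

open scoped Classical

namespace Summit.BirchSwinnertonDyer.BirchSwinnertonDyer.Rank2Observatory.TwoDescCubic

open WeierstrassCurve WeierstrassCurve.Affine WeierstrassCurve.Affine.Point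

variable {F K : Type*} [Field F] [Field K] {W : Affine F} (φ : F →+* K) {e : K}

/-! Throughout, *independence of `1, e, e²` over `F`* is the elementwise hypothesis
`hlin : ∀ c₀ c₁ c₂ : F, φ c₂ * e ^ 2 + φ c₁ * e + φ c₀ = 0 → c₀ = 0 ∧ c₁ = 0 ∧ c₂ = 0`. -/

variable {φ}

/-- `e ∉ φ(F)` when `1, e, e²` are independent. [folklore] -/
theorem ne_of_powIndep
    (hlin : ∀ c₀ c₁ c₂ : F, φ c₂ * e ^ 2 + φ c₁ * e + φ c₀ = 0 → c₀ = 0 ∧ c₁ = 0 ∧ c₂ = 0)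
    (x : F) : φ x ≠ e := by
  intro h
  have := hlin (-x) 1 0 (by rw [_root_.map_zero, zero_mul, zero_add, map_one, one_mul, map_neg, h,
    add_neg_cancel])
  exact one_ne_zero this.2.1

/-- The cubic `X³ + a₂X² + a₄X + a₆` has no root in `F` if it has a root `e` with `1, e, e²`
independent (else `e` would satisfy the quadratic cofactor). [folklore] -/
theorem cubic_ne_zero_of_powIndep
    (hlin : ∀ c₀ c₁ c₂ : F, φ c₂ * e ^ 2 + φ c₁ * e + φ c₀ = 0 → c₀ = 0 ∧ c₁ = 0 ∧ c₂ = 0)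
    (hroot : e ^ 3 + φ W.a₂ * e ^ 2 + φ W.a₄ * e + φ W.a₆ = 0) (s : F) :
    s ^ 3 + W.a₂ * s ^ 2 + W.a₄ * s + W.a₆ ≠ 0 := by
  intro hs
  have hes : e - φ s ≠ 0 := sub_ne_zero.mpr (ne_of_powIndep hlin s).symm
  -- `f(e) − f(s) = (e − s)(e² + (s + a₂)e + (s² + a₂s + a₄))`
  have hq : φ (1 : F) * e ^ 2 + φ (s + W.a₂) * e + φ (s ^ 2 + W.a₂ * s + W.a₄) = 0 := by
    have hs' := congrArg φ hs
    simp only [map_add, map_mul, map_pow, _root_.map_zero] at hs'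
    have h0 : (e - φ s) * (φ (1 : F) * e ^ 2 + φ (s + W.a₂) * e + φ (s ^ 2 + W.a₂ * s + W.a₄))
        = 0 := by
      simp only [map_one, map_add, map_mul, map_pow]
      linear_combination hroot - hs'
    exact (mul_eq_zero.mp h0).resolve_left hes
  exact one_ne_zero (hlin _ _ _ hq).2.2

/-- For `a₁ = a₃ = 0` the `2`-division cubic `4X³ + b₂X² + 2b₄X + b₆` is `4(X³ + a₂X² + a₄X + a₆)`.
[folklore] -/
theorem two_division_cubic_of_a (ha₁ : W.a₁ = 0) (ha₃ : W.a₃ = 0)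
    (hroot : e ^ 3 + φ W.a₂ * e ^ 2 + φ W.a₄ * e + φ W.a₆ = 0) :
    4 * e ^ 3 + φ W.b₂ * e ^ 2 + 2 * φ W.b₄ * e + φ W.b₆ = 0 := by
  rw [WeierstrassCurve.b₂, WeierstrassCurve.b₄, WeierstrassCurve.b₆, ha₁, ha₃]
  simp only [map_add, map_mul, map_pow, map_ofNat, _root_.map_zero]
  linear_combination 4 * hroot

variable [W.IsElliptic] [CharZero F]

/-- **Cassels' Lemma 2 (explicit halving).** `W : y² = x³ + a₂x² + a₄x + a₆` over `F`,
`e ∈ K` a root of the cubic with `1, e, e²` independent over `F`, `P = (a, b) ∈ E(F)` with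
`a − e = (p₂e² + p₁e + p₀)²`, `pᵢ ∈ F`. Then `P ∈ 2E(F)`.
[cite: Cassels1991LecturesEllipticCurves, §15 Lemma 2] -/
theorem exists_eq_two_nsmul_of_sub_eq_sq (ha₁ : W.a₁ = 0) (ha₃ : W.a₃ = 0)
    (hroot : e ^ 3 + φ W.a₂ * e ^ 2 + φ W.a₄ * e + φ W.a₆ = 0)
    (hlin : ∀ c₀ c₁ c₂ : F, φ c₂ * e ^ 2 + φ c₁ * e + φ c₀ = 0 → c₀ = 0 ∧ c₁ = 0 ∧ c₂ = 0)
    {a b : F} (h : W.Nonsingular a b) {p₀ p₁ p₂ : F}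
    (hsq : φ a - e = (φ p₂ * e ^ 2 + φ p₁ * e + φ p₀) ^ 2) :
    ∃ Q : W.Point, some a b h = 2 • Q := by
  have hE := h.1
  rw [equation_iff, ha₁, ha₃] at hE
  simp only [zero_mul, add_zero] at hE
  -- `hE : b ^ 2 = a ^ 3 + W.a₂ * a ^ 2 + W.a₄ * a + W.a₆`
  -- Step 1: `p₂ ≠ 0`
  have hp₂ : p₂ ≠ 0 := by
    intro h0
    rw [h0, _root_.map_zero, zero_mul, zero_add] at hsq
    have := hlin (p₀ ^ 2 - a) (2 * p₀ * p₁ + 1) (p₁ ^ 2) (by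
      simp only [map_sub, map_add, map_mul, map_pow, map_ofNat, map_one]
      linear_combination -hsq)
    have h1 : p₁ = 0 := pow_eq_zero_iff (n := 2) two_ne_zero |>.mp this.2.2
    have h2 := this.2.1
    rw [h1, mul_zero, zero_add] at h2
    exact one_ne_zero h2
  -- Step 2: `s₀, r₁, r₀` with `(s₀ − e)ρ = r₁e + r₀`
  obtain ⟨s₀, hs₀p⟩ : ∃ s₀ : F, s₀ * p₂ = p₁ - p₂ * W.a₂ :=
    ⟨(p₁ - p₂ * W.a₂) / p₂, div_mul_cancel₀ _ hp₂⟩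
  obtain ⟨r₁, hr₁⟩ : ∃ r₁ : F, r₁ = s₀ * p₁ - p₀ + p₂ * W.a₄ := ⟨_, rfl⟩
  obtain ⟨r₀, hr₀⟩ : ∃ r₀ : F, r₀ = s₀ * p₀ + p₂ * W.a₆ := ⟨_, rfl⟩
  have hlinE : (φ s₀ - e) * (φ p₂ * e ^ 2 + φ p₁ * e + φ p₀) = φ r₁ * e + φ r₀ := by
    have hs₀p' := congrArg φ hs₀p
    simp only [map_mul, map_sub] at hs₀p'
    rw [hr₁, hr₀]
    simp only [map_add, map_sub, map_mul]
    linear_combination (-(φ p₂)) * hroot + e ^ 2 * hs₀p'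
  -- Step 3: `(s₀ − e)²(a − e) = (r₁e + r₀)²`, reduced to degree ≤ 2 in `e`, gives three identities
  have hcube : (φ s₀ - e) ^ 2 * (φ a - e) = (φ r₁ * e + φ r₀) ^ 2 := by
    rw [hsq, ← hlinE]; ring
  have hco := hlin (r₀ ^ 2 - a * s₀ ^ 2 - W.a₆) (2 * r₀ * r₁ + 2 * a * s₀ + s₀ ^ 2 - W.a₄)
    (r₁ ^ 2 - a - 2 * s₀ - W.a₂) (by
      simp only [map_sub, map_add, map_mul, map_pow, map_ofNat]
      linear_combination -hcube - hroot)
  obtain ⟨h6, h4, h2⟩ := hco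
  -- `a₂ = r₁² − a − 2s₀`, `a₄ = 2r₀r₁ + 2as₀ + s₀²`, `a₆ = r₀² − a s₀²`
  -- Step 4: `Q = (s₀, t)`, `t = r₁s₀ + r₀`, lies on `W`, and is not `2`-torsion
  obtain ⟨t, ht⟩ : ∃ t : F, t = r₁ * s₀ + r₀ := ⟨_, rfl⟩
  have hQE : W.Equation s₀ t := by
    rw [equation_iff, ha₁, ha₃]
    simp only [zero_mul, add_zero]
    rw [ht]
    linear_combination s₀ ^ 2 * h2 + s₀ * h4 + h6
  have hQ : W.Nonsingular s₀ t := equation_iff_nonsingular.mp hQE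
  have ht0 : t ≠ 0 := by
    intro h0
    apply cubic_ne_zero_of_powIndep hlin hroot s₀
    have h' := hQE
    rw [equation_iff, ha₁, ha₃, h0] at h'
    simp only [zero_mul, add_zero, ne_eq, OfNat.ofNat_ne_zero, not_false_eq_true,
      zero_pow] at h'
    linear_combination -h'
  have hneg : W.negY s₀ t = -t := by rw [negY, ha₁, ha₃]; ring
  have hty : t ≠ W.negY s₀ t := by
    rw [hneg]; intro h0
    exact ht0 (by linear_combination h0 / 2)
  -- the tangent slope at `Q` is `r₁` and `x(2Q) = a`
  have hsl : W.slope s₀ s₀ t t = r₁ := by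
    rw [slope_of_Y_ne rfl hty, hneg, ha₁]
    have h2t : t - -t ≠ 0 := by
      rw [sub_neg_eq_add, ← two_mul]; exact mul_ne_zero two_ne_zero ht0
    rw [div_eq_iff h2t]
    linear_combination (-2 * s₀) * h2 - h4 - 2 * r₁ * ht
  have hx2 : W.addX s₀ s₀ (W.slope s₀ s₀ t t) = a := by
    rw [hsl, addX, ha₁]
    linear_combination h2
  -- Step 5: `2Q = (a, ±b)`
  have h2Q : (some s₀ t hQ : W.Point) + some s₀ t hQ =
      some (W.addX s₀ s₀ (W.slope s₀ s₀ t t)) (W.addY s₀ s₀ t (W.slope s₀ s₀ t t))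
        (nonsingular_add hQ hQ fun hxy => hty hxy.right) := add_self_of_Y_ne hty
  set y₃ := W.addY s₀ s₀ t (W.slope s₀ s₀ t t) with hy₃
  have h₃ : W.Nonsingular (W.addX s₀ s₀ (W.slope s₀ s₀ t t)) y₃ :=
    nonsingular_add hQ hQ fun hxy => hty hxy.right
  have h₃' : W.Nonsingular a y₃ := hx2 ▸ h₃
  have h2Q' : (some s₀ t hQ : W.Point) + some s₀ t hQ = some a y₃ h₃' := by
    rw [h2Q]
    congr 1
  rcases Y_eq_of_X_eq h₃'.1 h.1 rfl with hy | hy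
  · refine ⟨some s₀ t hQ, ?_⟩
    rw [two_nsmul, h2Q']
    congr 1
    exact hy.symm
  · refine ⟨-some s₀ t hQ, ?_⟩
    rw [two_nsmul, ← neg_add, h2Q', neg_some]
    congr 1
    rw [hy, negY_negY]

/-- **Kernel of `μ` is `2E(F)`** (LEC §15 Lemma 2) in the square-class form: with `K = F(e)`
(every element an `F`-combination of `1, e, e²`), an affine `P = (a, b) ∈ E(F)` whose class
`(φ a − e)·(Kˣ)²` is trivial is a double. [cite: Cassels1991LecturesEllipticCurves, §15 Lemma 2] -/
theorem exists_eq_two_nsmul_of_sqClass_eq_one (ha₁ : W.a₁ = 0) (ha₃ : W.a₃ = 0)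
    (hroot : e ^ 3 + φ W.a₂ * e ^ 2 + φ W.a₄ * e + φ W.a₆ = 0)
    (hlin : ∀ c₀ c₁ c₂ : F, φ c₂ * e ^ 2 + φ c₁ * e + φ c₀ = 0 → c₀ = 0 ∧ c₁ = 0 ∧ c₂ = 0)
    (hspan : ∀ z : K, ∃ c₀ c₁ c₂ : F, z = φ c₂ * e ^ 2 + φ c₁ * e + φ c₀)
    {a b : F} (h : W.Nonsingular a b) (h1 : sqClass (φ a - e) = 1) :
    ∃ Q : W.Point, some a b h = 2 • Q := by
  have hne : φ a - e ≠ 0 := sub_ne_zero.mpr (ne_of_powIndep hlin a)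
  obtain ⟨u, hu⟩ := (sqClass_eq_one_iff hne).mp h1
  obtain ⟨p₀, p₁, p₂, rfl⟩ := hspan u
  exact exists_eq_two_nsmul_of_sub_eq_sq ha₁ ha₃ hroot hlin h hu

/-- **`ker μ ⊆ 2E(F)`** for the descent map `muMap` (Cassels' Lemma 2, point form, including `P = 0`).
[cite: Cassels1991LecturesEllipticCurves, §15 Lemma 2] -/
theorem exists_eq_two_nsmul_of_muMap_eq_one (ha₁ : W.a₁ = 0) (ha₃ : W.a₃ = 0)
    (hroot : e ^ 3 + φ W.a₂ * e ^ 2 + φ W.a₄ * e + φ W.a₆ = 0)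
    (hlin : ∀ c₀ c₁ c₂ : F, φ c₂ * e ^ 2 + φ c₁ * e + φ c₀ = 0 → c₀ = 0 ∧ c₁ = 0 ∧ c₂ = 0)
    (hspan : ∀ z : K, ∃ c₀ c₁ c₂ : F, z = φ c₂ * e ^ 2 + φ c₁ * e + φ c₀)
    (P : W.Point) (h1 : muMap W φ e P = 1) : ∃ Q : W.Point, P = 2 • Q := by
  rcases P with _ | @⟨a, b, h⟩
  · exact ⟨0, (smul_zero 2).symm⟩
  · rw [muMap_some] at h1
    exact exists_eq_two_nsmul_of_sqClass_eq_one ha₁ ha₃ hroot hlin hspan h h1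

/-- **`ker μ ⊆ 2E(F)`** in the shape of the hypothesis `hker` of `two_pow_finrank_le_natCard_range`
/ `two_pow_finrank_le_card` (so `2 ^ rank E(F) ≤ #μ(E(F))`).
[cite: Cassels1991LecturesEllipticCurves, §15 Lemma 2] -/
theorem muHom_ker_le [CharZero K] (ha₁ : W.a₁ = 0) (ha₃ : W.a₃ = 0)
    (hroot : e ^ 3 + φ W.a₂ * e ^ 2 + φ W.a₄ * e + φ W.a₆ = 0)
    (hlin : ∀ c₀ c₁ c₂ : F, φ c₂ * e ^ 2 + φ c₁ * e + φ c₀ = 0 → c₀ = 0 ∧ c₁ = 0 ∧ c₂ = 0)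
    (hspan : ∀ z : K, ∃ c₀ c₁ c₂ : F, z = φ c₂ * e ^ 2 + φ c₁ * e + φ c₀) (P : W.Point)
    (h0 : muHom W φ e (two_division_cubic_of_a ha₁ ha₃ hroot) (ne_of_powIndep hlin) P = 0) :
    ∃ Q : W.Point, P = 2 • Q := by
  rw [muHom_apply, ofMul_eq_zero] at h0
  exact exists_eq_two_nsmul_of_muMap_eq_one ha₁ ha₃ hroot hlin hspan P h0

end Summit.BirchSwinnertonDyer.BirchSwinnertonDyer.Rank2Observatory.TwoDescCubic

end
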